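import Literature.Analysis.FluidPDE.HardSphereCollisionTimeMeasurable
import HarnessLib

/-!
# The clamped (relevant) collision times of a window are enumerated measurably in the datum

Companion to `Literature.Analysis.FluidPDE.HardSphereWindowEnumeration` (on the good set of a
hard-sphere flow `Φ`, the collision times of the window `(0, h]` having a participant `i` for which
they are not later than the CLAMP of `i` — the time of its collision of index `K` if `i` has at
least `K + 1` collisions in the window, else `h` — are among the enumerated collision times
`Φ.nthCollisionTimeOf i n z`, `n ≤ K`) and to `HardSphereCollisionTimeMeasurable` (each
`z ↦ Φ.nthCollisionTimeOf i n z` is measurable on the good set, and so is the event "`i` has at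
least `n + 1` collisions in `(0, h]`").  Combining the two: the increasing enumeration
`m ↦ nthTimeAfter R(z) 0 m` of the set `R(z)` of clamped collision times, the events "`R(z)` has at
least `m + 1` elements" and the configuration at the `m`-th clamped time are measurable in the
initial datum on the good set — the bookkeeping making the coarse collision filtrations "marks of
the first `m` relevant collisions of a window" sub-σ-algebras of the Borel σ-algebra of phase
space (Kipnis–Landim 1999 App. 1 §5–6, Dynkin martingales along collision filtrations;
Gallagher–Saint-Raymond–Texier 2013 §4.1–4.2 and Cercignani–Illner–Pulvirenti 1994 App. 4.A, where
measurability of collision-indexed functionals is implicit whenever they are integrated).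

* PURE MEASURE THEORY (any measurable space `α`, finite index type `ι`): for measurable real
  functions `T j`, measurable events `A j` and the finite random set `S(a) = {T j a | A j a}`, the
  next element of `S(a)` after a measurable time is measurable
  (`measurable_nextTimeAfter_setOf_exists`, level sets `nextTimeAfter_setOf_exists_le_iff`), hence
  so is the `n`-th one (`measurable_nthTimeAfter_setOf_exists`), and "at least `m + 1` elements of
  `S(a)` in a window" is a measurable event (`measurableSet_lt_ncard_setOf_exists_inter_Ioc`, chain
  form `lt_ncard_window_iff_chain`);
* `measurableSet_participates` — "`i` participates in a collision" is a measurable event;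
* along a hard-sphere flow, on the good set (continuous separation distance, measurable separation
  map): `HardSphereFlow.measurable_clamp_comp_subtype`; the clamped collision times are the finite
  measurably indexed family `{Φ.nthCollisionTimeOf i k z | k ≤ K, k < Jᵢ(z)}`
  (`setOf_clampedTimes_eq_setOf_exists`); hence `measurable_nthTimeAfter_clampedTimes_comp_subtype`,
  `measurableSet_lt_ncard_clampedTimes`, `measurable_flow_nthTimeAfter_clampedTimes_comp_subtype`
  (joint measurability of the flow); torus specialisations `…_torus`.

No new definitions: the clamp is written inline as
`if K + 1 ≤ Jᵢ then max 0 (min h (Φ.nthCollisionTimeOf i K z)) else h`,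
`Jᵢ = (collisionTimesOf G ε (fun s => Φ.flow s z) i ∩ Ioc 0 h).ncard`, exactly as in
`HardSphereFlow.ncard_clampedTimes_le`.  Reused: `measurable_of_Iic`, `Measurable.ite`,
`measurableSet_lt`, `Finset.measurableSet_biInter` (Mathlib); `isLeast_nextTimeAfter`,
`lt_ncard_window_iff_chain`, `measurableSet_collide`,
`HardSphereFlow.setOf_collisionTimesOf_le_clamp_eq_image`, `….measurable_nthCollisionTimeOf_comp_subtype`,
`….measurableSet_lt_ncard_collisionTimesOf_window`, `….measurable_flow_prod` (Literature).

## References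

* C. Kipnis, C. Landim, *Scaling Limits of Interacting Particle Systems* (1999), App. 1 §5–6.
* I. Gallagher, L. Saint-Raymond, B. Texier, *From Newton to Boltzmann* (2013), §4.1–4.2.
* C. Cercignani, R. Illner, M. Pulvirenti, *The Mathematical Theory of Dilute Gases* (1994), App. 4.A.
-/

open Set Function MeasureTheory

namespace Literature.Analysis.FluidPDE

noncomputable section

/-! ## Enumerating the finite random set of active values of a finite measurable family -/

section FiniteFamily

variable {α ι : Type*} [Finite ι]

/-- The set of values of the active members of a finite family of real functions is finite.
[folklore] -/
theorem finite_setOf_exists_and_eq (A : ι → α → Prop) (T : ι → α → ℝ) (a : α) :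
    {t | ∃ j, A j a ∧ T j a = t}.Finite :=
  (Set.finite_range fun j => T j a).subset fun _ ⟨j, _, hj⟩ => ⟨j, hj⟩

/-- **Level sets of the next active value.**  For the finite set `S = {T j a | A j a}`:
`nextTimeAfter S x ≤ c` iff some active value lies in `(x, c]`, or no active value exceeds `x` and
`0 ≤ c` (the junk value `0 = sInf ∅` of `nextTimeAfter`). [folklore] -/
theorem nextTimeAfter_setOf_exists_le_iff (A : ι → α → Prop) (T : ι → α → ℝ) (a : α) (x c : ℝ) :
    nextTimeAfter {t | ∃ j, A j a ∧ T j a = t} x ≤ c ↔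
      (∃ j, A j a ∧ x < T j a ∧ T j a ≤ c) ∨ ((∀ j, A j a → T j a ≤ x) ∧ 0 ≤ c) := by
  have hfin : ∀ b, ({t | ∃ j, A j a ∧ T j a = t} ∩ Ioc x b).Finite := fun b =>
    (finite_setOf_exists_and_eq A T a).subset inter_subset_left
  by_cases hne : ({t | ∃ j, A j a ∧ T j a = t} ∩ Ioi x).Nonempty
  · have hl := isLeast_nextTimeAfter hfin hne
    obtain ⟨⟨j, hj, hjt⟩, hxt⟩ := hl.1
    constructor
    · intro hc
      refine Or.inl ⟨j, hj, ?_, ?_⟩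
      · rw [hjt]; exact hxt
      · rw [hjt]; exact hc
    · rintro (⟨j', hj', hxj', hj'c⟩ | ⟨hall, -⟩)
      · exact (hl.2 ⟨⟨j', hj', rfl⟩, hxj'⟩).trans hj'c
      · have h1 := hall j hj
        rw [hjt] at h1
        exact absurd h1 (not_le.2 hxt)
  · have hempty : {t | ∃ j, A j a ∧ T j a = t} ∩ Ioi x = ∅ := not_nonempty_iff_eq_empty.1 hne
    rw [nextTimeAfter_of_eq_empty hempty]
    constructor
    · intro hc
      refine Or.inr ⟨fun j hj => ?_, hc⟩
      by_contra hlt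
      exact hne ⟨T j a, ⟨j, hj, rfl⟩, not_le.1 hlt⟩
    · rintro (⟨j, hj, hxj, -⟩ | ⟨-, hc⟩)
      · exact absurd ⟨T j a, ⟨j, hj, rfl⟩, hxj⟩ hne
      · exact hc

variable [MeasurableSpace α]

/-- **The next active value after a measurable time is measurable** (finite family of measurable
real functions `T j`, measurable activity events `A j`, measurable time `x`). [folklore] -/
theorem measurable_nextTimeAfter_setOf_exists {A : ι → α → Prop} (hA : ∀ j, MeasurableSet {a | A j a})
    {T : ι → α → ℝ} (hT : ∀ j, Measurable (T j)) {x : α → ℝ} (hx : Measurable x) :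
    Measurable fun a => nextTimeAfter {t | ∃ j, A j a ∧ T j a = t} (x a) := by
  refine measurable_of_Iic fun c => ?_
  have hset : (fun a => nextTimeAfter {t | ∃ j, A j a ∧ T j a = t} (x a)) ⁻¹' Iic c =
      (⋃ j, ({a | A j a} ∩ {a | x a < T j a}) ∩ {a | T j a ≤ c}) ∪
        ((⋂ j, ({a | A j a}ᶜ ∪ {a | T j a ≤ x a})) ∩ {_a | (0 : ℝ) ≤ c}) := by
    ext a
    simp only [mem_preimage, mem_Iic, mem_union, mem_iUnion, mem_inter_iff, mem_setOf_eq,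
      mem_iInter, mem_compl_iff]
    rw [nextTimeAfter_setOf_exists_le_iff]
    simp only [and_assoc, imp_iff_not_or]
  rw [hset]
  exact (MeasurableSet.iUnion fun j => ((hA j).inter (measurableSet_lt hx (hT j))).inter
    (measurableSet_le (hT j) measurable_const)).union
    ((MeasurableSet.iInter fun j => (hA j).compl.union (measurableSet_le (hT j) hx)).inter
      (measurableSet_le measurable_const measurable_const))

/-- **The `n`-th active value after a measurable time is measurable** (iterate the previous
lemma along `nthTimeAfter_succ`). [folklore] -/
theorem measurable_nthTimeAfter_setOf_exists {A : ι → α → Prop} (hA : ∀ j, MeasurableSet {a | A j a})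
    {T : ι → α → ℝ} (hT : ∀ j, Measurable (T j)) {x : α → ℝ} (hx : Measurable x) (n : ℕ) :
    Measurable fun a => nthTimeAfter {t | ∃ j, A j a ∧ T j a = t} (x a) n := by
  induction n with
  | zero => simpa only [nthTimeAfter_zero] using measurable_nextTimeAfter_setOf_exists hA hT hx
  | succ n ih =>
    simpa only [nthTimeAfter_succ] using measurable_nextTimeAfter_setOf_exists hA hT ih

/-- **"At least `m + 1` active values in the window `(lo, hi]`" is a measurable event** (origin
`lo ≥ 0`; chain form `lo < t₀ < ⋯ < t_m ≤ hi` of the window count, `lt_ncard_window_iff_chain`).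
[folklore] -/
theorem measurableSet_lt_ncard_setOf_exists_inter_Ioc {A : ι → α → Prop}
    (hA : ∀ j, MeasurableSet {a | A j a}) {T : ι → α → ℝ} (hT : ∀ j, Measurable (T j)) {lo : ℝ}
    (hlo : 0 ≤ lo) (hi : ℝ) (m : ℕ) :
    MeasurableSet {a | m < ({t | ∃ j, A j a ∧ T j a = t} ∩ Ioc lo hi).ncard} := by
  have hnth : ∀ k, Measurable fun a => nthTimeAfter {t | ∃ j, A j a ∧ T j a = t} lo k := fun k =>
    measurable_nthTimeAfter_setOf_exists hA hT measurable_const k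
  have hset : {a | m < ({t | ∃ j, A j a ∧ T j a = t} ∩ Ioc lo hi).ncard} =
      ({a | lo < nthTimeAfter {t | ∃ j, A j a ∧ T j a = t} lo 0} ∩
        ⋂ k ∈ Finset.range m, {a | nthTimeAfter {t | ∃ j, A j a ∧ T j a = t} lo k <
          nthTimeAfter {t | ∃ j, A j a ∧ T j a = t} lo (k + 1)}) ∩
        {a | nthTimeAfter {t | ∃ j, A j a ∧ T j a = t} lo m ≤ hi} := by
    ext a
    simp only [mem_setOf_eq, mem_inter_iff, mem_iInter, Finset.mem_range]
    rw [lt_ncard_window_iff_chain (fun p q =>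
      (finite_setOf_exists_and_eq A T a).subset inter_subset_left) hlo hi m]
    tauto
  rw [hset]
  exact ((measurableSet_lt measurable_const (hnth 0)).inter
    (Finset.measurableSet_biInter _ fun k _ => measurableSet_lt (hnth k) (hnth (k + 1)))).inter
    (measurableSet_le (hnth m) measurable_const)

end FiniteFamily

/-! ## Participation is a measurable event of the configuration -/

section Participation

variable {d : Type*} [Fintype d] {X : Type*} [MeasurableSpace X] {N : ℕ} {G : Geometry d X} {ε : ℝ}

/-- **"Particle `i` participates in a collision" is a measurable event of the configuration**
(measurable separation map): the finite union over `l` of the events "`i` and `l` collide"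
(`measurableSet_collide`). [folklore] -/
theorem measurableSet_participates (hG : Measurable fun p : X × X => G.sepVec p.1 p.2) (i : Fin N) :
    MeasurableSet {z : Config N d X | Participates G ε z i} := by
  have h : {z : Config N d X | Participates G ε z i} = ⋃ l, {z : Config N d X | Collide G ε z i l} := by
    ext z
    simp only [Participates, mem_setOf_eq, mem_iUnion]
  rw [h]
  exact MeasurableSet.iUnion fun l => measurableSet_collide hG i l

end Participation

/-! ## Along a hard-sphere flow: the clamped collision times of a window -/

section Kinetic

variable {d : Type*} [Fintype d] {X : Type*} [MeasureSpace X] [TopologicalSpace X] {N : ℕ}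
  {G : Geometry d X} {ε : ℝ}

namespace HardSphereFlow

variable (Φ : HardSphereFlow G ε N)

/-- **The clamp of a particle is measurable on the good set**: the time of its collision of index
`K` if it has at least `K + 1` collisions in `(0, h]` (a measurable event, chain form), clamped into
`[0, h]`, else `h`. [folklore] -/
theorem measurable_clamp_comp_subtype (hGc : Continuous fun p : X × X => ‖G.sepVec p.1 p.2‖)
    (hGm : Measurable fun p : X × X => G.sepVec p.1 p.2) (i : Fin N) (h : ℝ) (K : ℕ) :
    Measurable fun z : Φ.good =>
      if K + 1 ≤ (collisionTimesOf G ε (fun s => Φ.flow s (z : Config N d X)) i ∩ Ioc 0 h).ncard then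
        max 0 (min h (Φ.nthCollisionTimeOf i K (z : Config N d X))) else h :=
  Measurable.ite (Φ.measurableSet_lt_ncard_collisionTimesOf_window hGc hGm i h K)
    (measurable_const.max (measurable_const.min
      (Φ.measurable_nthCollisionTimeOf_comp_subtype hGc hGm i K))) measurable_const

/-- **The clamped collision times are a finite measurably indexed family.**  On the good set, the
collision times of `(0, h]` having a participant for which they are not later than its clamp are
exactly the values `Φ.nthCollisionTimeOf i k z`, `k ≤ K`, `k < Jᵢ(z)` (number of collisions of `i` in
the window) — `HardSphereFlow.setOf_collisionTimesOf_le_clamp_eq_image` particle by particle.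
[folklore] -/
theorem setOf_clampedTimes_eq_setOf_exists {z : Config N d X} (hz : z ∈ Φ.good) (h : ℝ) (K : ℕ) :
    {t | t ∈ collisionTimes G ε (fun s => Φ.flow s z) ∧ t ∈ Ioc 0 h ∧
        ∃ i, Participates G ε (Φ.flow t z) i ∧
          t ≤ (if K + 1 ≤ (collisionTimesOf G ε (fun s => Φ.flow s z) i ∩ Ioc 0 h).ncard then
                max 0 (min h (Φ.nthCollisionTimeOf i K z)) else h)} =
      {t | ∃ p : Fin N × Fin (K + 1),
        (p.2 : ℕ) < (collisionTimesOf G ε (fun s => Φ.flow s z) p.1 ∩ Ioc 0 h).ncard ∧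
          Φ.nthCollisionTimeOf p.1 p.2 z = t} := by
  ext t
  simp only [mem_setOf_eq]
  constructor
  · rintro ⟨-, htw, i, hpi, hti⟩
    have ht : t ∈ (fun n => Φ.nthCollisionTimeOf i n z) ''
        Iio (min (collisionTimesOf G ε (fun s => Φ.flow s z) i ∩ Ioc 0 h).ncard (K + 1)) := by
      rw [← Φ.setOf_collisionTimesOf_le_clamp_eq_image hz i h K]
      exact ⟨hpi, htw, hti⟩
    obtain ⟨n, hn, rfl⟩ := ht
    rw [mem_Iio, lt_min_iff] at hn
    exact ⟨(i, ⟨n, hn.2⟩), hn.1, rfl⟩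
  · rintro ⟨⟨i, k⟩, hk, rfl⟩
    have ht : Φ.nthCollisionTimeOf i k z ∈ (fun n => Φ.nthCollisionTimeOf i n z) ''
        Iio (min (collisionTimesOf G ε (fun s => Φ.flow s z) i ∩ Ioc 0 h).ncard (K + 1)) :=
      ⟨k, lt_min hk k.2, rfl⟩
    rw [← Φ.setOf_collisionTimesOf_le_clamp_eq_image hz i h K] at ht
    obtain ⟨hpi, htw, hti⟩ := ht
    exact ⟨collisionTimesOf_subset _ i hpi, htw, i, hpi, hti⟩

/-- **The enumeration of the clamped collision times is measurable on the good set**: for every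
`m`, `z ↦ nthTimeAfter R(z) 0 m` (the time of the `m`-th clamped collision of the window, `m = 0`
the first; junk beyond their number) is measurable, `R(z)` the set of clamped collision times.
[folklore] -/
theorem measurable_nthTimeAfter_clampedTimes_comp_subtype
    (hGc : Continuous fun p : X × X => ‖G.sepVec p.1 p.2‖)
    (hGm : Measurable fun p : X × X => G.sepVec p.1 p.2) (h : ℝ) (K m : ℕ) :
    Measurable fun z : Φ.good => nthTimeAfter
      {t | t ∈ collisionTimes G ε (fun s => Φ.flow s (z : Config N d X)) ∧ t ∈ Ioc 0 h ∧
        ∃ i, Participates G ε (Φ.flow t (z : Config N d X)) i ∧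
          t ≤ (if K + 1 ≤ (collisionTimesOf G ε (fun s => Φ.flow s (z : Config N d X)) i ∩
                  Ioc 0 h).ncard then
                max 0 (min h (Φ.nthCollisionTimeOf i K (z : Config N d X))) else h)} 0 m := by
  have hA : ∀ p : Fin N × Fin (K + 1), MeasurableSet {z : Φ.good |
      (p.2 : ℕ) < (collisionTimesOf G ε (fun s => Φ.flow s (z : Config N d X)) p.1 ∩ Ioc 0 h).ncard} :=
    fun p => Φ.measurableSet_lt_ncard_collisionTimesOf_window hGc hGm p.1 h p.2
  have hT : ∀ p : Fin N × Fin (K + 1), Measurable fun z : Φ.good =>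
      Φ.nthCollisionTimeOf p.1 p.2 (z : Config N d X) :=
    fun p => Φ.measurable_nthCollisionTimeOf_comp_subtype hGc hGm p.1 p.2
  have heq : (fun z : Φ.good => nthTimeAfter
      {t | t ∈ collisionTimes G ε (fun s => Φ.flow s (z : Config N d X)) ∧ t ∈ Ioc 0 h ∧
        ∃ i, Participates G ε (Φ.flow t (z : Config N d X)) i ∧
          t ≤ (if K + 1 ≤ (collisionTimesOf G ε (fun s => Φ.flow s (z : Config N d X)) i ∩
                  Ioc 0 h).ncard then
                max 0 (min h (Φ.nthCollisionTimeOf i K (z : Config N d X))) else h)} 0 m) =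
      fun z : Φ.good => nthTimeAfter {t | ∃ p : Fin N × Fin (K + 1),
        (p.2 : ℕ) < (collisionTimesOf G ε (fun s => Φ.flow s (z : Config N d X)) p.1 ∩
            Ioc 0 h).ncard ∧
          Φ.nthCollisionTimeOf p.1 p.2 (z : Config N d X) = t} ((fun _ => (0 : ℝ)) z) m := by
    funext z
    rw [Φ.setOf_clampedTimes_eq_setOf_exists z.2 h K]
  rw [heq]
  exact measurable_nthTimeAfter_setOf_exists hA hT measurable_const m

/-- **"At least `m + 1` clamped collision times" is a measurable event on the good set.**
[folklore] -/
theorem measurableSet_lt_ncard_clampedTimes (hGc : Continuous fun p : X × X => ‖G.sepVec p.1 p.2‖)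
    (hGm : Measurable fun p : X × X => G.sepVec p.1 p.2) (h : ℝ) (K m : ℕ) :
    MeasurableSet {z : Φ.good | m <
      ({t | t ∈ collisionTimes G ε (fun s => Φ.flow s (z : Config N d X)) ∧ t ∈ Ioc 0 h ∧
        ∃ i, Participates G ε (Φ.flow t (z : Config N d X)) i ∧
          t ≤ (if K + 1 ≤ (collisionTimesOf G ε (fun s => Φ.flow s (z : Config N d X)) i ∩
                  Ioc 0 h).ncard then
                max 0 (min h (Φ.nthCollisionTimeOf i K (z : Config N d X))) else h)}).ncard} := by
  have hA : ∀ p : Fin N × Fin (K + 1), MeasurableSet {z : Φ.good |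
      (p.2 : ℕ) < (collisionTimesOf G ε (fun s => Φ.flow s (z : Config N d X)) p.1 ∩ Ioc 0 h).ncard} :=
    fun p => Φ.measurableSet_lt_ncard_collisionTimesOf_window hGc hGm p.1 h p.2
  have hT : ∀ p : Fin N × Fin (K + 1), Measurable fun z : Φ.good =>
      Φ.nthCollisionTimeOf p.1 p.2 (z : Config N d X) :=
    fun p => Φ.measurable_nthCollisionTimeOf_comp_subtype hGc hGm p.1 p.2
  have heq : {z : Φ.good | m <
      ({t | t ∈ collisionTimes G ε (fun s => Φ.flow s (z : Config N d X)) ∧ t ∈ Ioc 0 h ∧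
        ∃ i, Participates G ε (Φ.flow t (z : Config N d X)) i ∧
          t ≤ (if K + 1 ≤ (collisionTimesOf G ε (fun s => Φ.flow s (z : Config N d X)) i ∩
                  Ioc 0 h).ncard then
                max 0 (min h (Φ.nthCollisionTimeOf i K (z : Config N d X))) else h)}).ncard} =
      {z : Φ.good | m < ({t | ∃ p : Fin N × Fin (K + 1),
        (p.2 : ℕ) < (collisionTimesOf G ε (fun s => Φ.flow s (z : Config N d X)) p.1 ∩
            Ioc 0 h).ncard ∧
          Φ.nthCollisionTimeOf p.1 p.2 (z : Config N d X) = t} ∩ Ioc 0 h).ncard} := by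
    ext z
    simp only [mem_setOf_eq]
    rw [Φ.setOf_clampedTimes_eq_setOf_exists z.2 h K, inter_eq_left.2]
    rintro t ⟨p, hp, rfl⟩
    exact (Φ.nthCollisionTimeOf_mem_window z.2 p.1 hp).2
  rw [heq]
  exact measurableSet_lt_ncard_setOf_exists_inter_Ioc hA hT le_rfl h m

/-- **The configuration at the `m`-th clamped collision time is measurable on the good set**
(joint measurability of the flow on `good × ℝ`: metrizable second-countable Borel position space,
continuous translations). [folklore] -/
theorem measurable_flow_nthTimeAfter_clampedTimes_comp_subtype
    [TopologicalSpace.PseudoMetrizableSpace X] [SecondCountableTopology X] [BorelSpace X]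
    (hGt : ∀ x : X, Continuous (G.translate x))
    (hGc : Continuous fun p : X × X => ‖G.sepVec p.1 p.2‖)
    (hGm : Measurable fun p : X × X => G.sepVec p.1 p.2) (h : ℝ) (K m : ℕ) :
    Measurable fun z : Φ.good => Φ.flow (nthTimeAfter
      {t | t ∈ collisionTimes G ε (fun s => Φ.flow s (z : Config N d X)) ∧ t ∈ Ioc 0 h ∧
        ∃ i, Participates G ε (Φ.flow t (z : Config N d X)) i ∧
          t ≤ (if K + 1 ≤ (collisionTimesOf G ε (fun s => Φ.flow s (z : Config N d X)) i ∩
                  Ioc 0 h).ncard then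
                max 0 (min h (Φ.nthCollisionTimeOf i K (z : Config N d X))) else h)} 0 m)
      (z : Config N d X) :=
  (Φ.measurable_flow_prod hGt).comp (measurable_id.prodMk
    (Φ.measurable_nthTimeAfter_clampedTimes_comp_subtype hGc hGm h K m))

end HardSphereFlow

end Kinetic

/-! ## The flat torus -/

section TorusGeometry

variable {d : Type*} [Fintype d] {N : ℕ} {ε : ℝ}

/-- On `𝕋^d`: the clamp of a particle is measurable on the good set. [folklore] -/
theorem HardSphereFlow.measurable_clamp_comp_subtype_torus (Φ : HardSphereFlow (Torus.geometry d) ε N)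
    (i : Fin N) (h : ℝ) (K : ℕ) :
    Measurable fun z : Φ.good =>
      if K + 1 ≤ (collisionTimesOf (Torus.geometry d) ε
          (fun s => Φ.flow s (z : Config N d (UnitAddTorus d))) i ∩ Ioc 0 h).ncard then
        max 0 (min h (Φ.nthCollisionTimeOf i K (z : Config N d (UnitAddTorus d)))) else h :=
  Φ.measurable_clamp_comp_subtype
    (Torus.continuous_norm_reprSym.comp (continuous_fst.sub continuous_snd))
    Torus.measurable_geometry_sepVec i h K

/-- On `𝕋^d`: the enumeration of the clamped collision times of `(0, h]` is measurable on the good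
set. [folklore] -/
theorem HardSphereFlow.measurable_nthTimeAfter_clampedTimes_comp_subtype_torus
    (Φ : HardSphereFlow (Torus.geometry d) ε N) (h : ℝ) (K m : ℕ) :
    Measurable fun z : Φ.good => nthTimeAfter
      {t | t ∈ collisionTimes (Torus.geometry d) ε
          (fun s => Φ.flow s (z : Config N d (UnitAddTorus d))) ∧ t ∈ Ioc 0 h ∧
        ∃ i, Participates (Torus.geometry d) ε (Φ.flow t (z : Config N d (UnitAddTorus d))) i ∧
          t ≤ (if K + 1 ≤ (collisionTimesOf (Torus.geometry d) ε
                  (fun s => Φ.flow s (z : Config N d (UnitAddTorus d))) i ∩ Ioc 0 h).ncard then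
                max 0 (min h (Φ.nthCollisionTimeOf i K (z : Config N d (UnitAddTorus d))))
              else h)} 0 m :=
  Φ.measurable_nthTimeAfter_clampedTimes_comp_subtype
    (Torus.continuous_norm_reprSym.comp (continuous_fst.sub continuous_snd))
    Torus.measurable_geometry_sepVec h K m

/-- On `𝕋^d`: "at least `m + 1` clamped collision times in `(0, h]`" is a measurable event on the
good set. [folklore] -/
theorem HardSphereFlow.measurableSet_lt_ncard_clampedTimes_torus
    (Φ : HardSphereFlow (Torus.geometry d) ε N) (h : ℝ) (K m : ℕ) :
    MeasurableSet {z : Φ.good | m <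
      ({t | t ∈ collisionTimes (Torus.geometry d) ε
          (fun s => Φ.flow s (z : Config N d (UnitAddTorus d))) ∧ t ∈ Ioc 0 h ∧
        ∃ i, Participates (Torus.geometry d) ε (Φ.flow t (z : Config N d (UnitAddTorus d))) i ∧
          t ≤ (if K + 1 ≤ (collisionTimesOf (Torus.geometry d) ε
                  (fun s => Φ.flow s (z : Config N d (UnitAddTorus d))) i ∩ Ioc 0 h).ncard then
                max 0 (min h (Φ.nthCollisionTimeOf i K (z : Config N d (UnitAddTorus d))))
              else h)}).ncard} :=
  Φ.measurableSet_lt_ncard_clampedTimes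
    (Torus.continuous_norm_reprSym.comp (continuous_fst.sub continuous_snd))
    Torus.measurable_geometry_sepVec h K m

/-- On `𝕋^d`: the configuration at the `m`-th clamped collision time of `(0, h]` is measurable on
the good set. [folklore] -/
theorem HardSphereFlow.measurable_flow_nthTimeAfter_clampedTimes_comp_subtype_torus
    (Φ : HardSphereFlow (Torus.geometry d) ε N) (h : ℝ) (K m : ℕ) :
    Measurable fun z : Φ.good => Φ.flow (nthTimeAfter
      {t | t ∈ collisionTimes (Torus.geometry d) ε
          (fun s => Φ.flow s (z : Config N d (UnitAddTorus d))) ∧ t ∈ Ioc 0 h ∧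
        ∃ i, Participates (Torus.geometry d) ε (Φ.flow t (z : Config N d (UnitAddTorus d))) i ∧
          t ≤ (if K + 1 ≤ (collisionTimesOf (Torus.geometry d) ε
                  (fun s => Φ.flow s (z : Config N d (UnitAddTorus d))) i ∩ Ioc 0 h).ncard then
                max 0 (min h (Φ.nthCollisionTimeOf i K (z : Config N d (UnitAddTorus d))))
              else h)} 0 m) (z : Config N d (UnitAddTorus d)) :=
  Φ.measurable_flow_nthTimeAfter_clampedTimes_comp_subtype
    (fun x => (continuous_const.add FunctionSpaces.Torus.continuous_proj :
      Continuous fun v : EuclideanSpace ℝ d => x + FunctionSpaces.Torus.proj v))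
    (Torus.continuous_norm_reprSym.comp (continuous_fst.sub continuous_snd))
    Torus.measurable_geometry_sepVec h K m

end TorusGeometry

end

end Literature.Analysis.FluidPDE
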